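import Literature.AnabelianGeometry.SemiGraphs.TemperedTopCyclicLocalTransport
import Literature.AnabelianGeometry.SemiGraphs.TemperedLocalLevelEstrangementSame
import HarnessLib

/-!
# [SemiAnbd] Thm 3.7 (iii) / Cor 3.9 (R3c) for TOPOLOGICALLY CYCLIC edge groups: the one-level local
# transport of fixed branches PRESERVES IMAGES at a lower level (proof-only)

Mochizuki, *Semi-graphs of anabelioids*, Publ. RIMS **42** (2006), §2 Remark 2.2.1 p. 24 ("the image
of each `Π_b` in `Π_𝒢` is equal to the stabilizer of a compatible system of edges") and §3 Theorem 3.7 (iii),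
proof p. 41, third paragraph, with the author's *Comments* (2020) (6)(b); Corollary 3.9, proof p. 43
l. 13 (the cell's step (R3c), FACT-LIST rows F-2772 `EdgeLikeCentralizerAt` / F-2773 `EdgeLikeCentralizer`)
[cite: MochizukiSemiAnbd2006, Thm 3.7(iii) p.41].

PROOF-ONLY (cell abc-iut, block F, seat abc-iut-f-172 gen 7; brick (A⁺) of «(R3c)@TOP-CYCLIC-CORE», the
instance class «ALL edge groups topologically cyclic, ANY underlying graph — cycles, loops and
infinitely-branching cores allowed» for the residual of F-2772/F-2773; no definition, no named fact).
abc-iut-f-175 gen 3's brick (A) `GaloisLevelData.exists_fixed_branch_transport` (one level `n` of a Galois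
tower, topologically cyclic `Π_{e(b₀)}`): if a subgroup `C` of `π₁^temp(𝒢)` fixes the edge of a branch `α`
over `b₀` at a tree vertex `v_a` over `w`, and the edges of branches `β` over `b₀` and `β'` over `b₁` at a
tree vertex `v` over `w`, then `C` fixes the edge of a branch `α'` over `b₁` AT `v_a`.  Here the SAME
transport is shown to respect the transition map `𝔾̃_n → 𝔾̃_j` (`j ≤ n`):
**if `α` and `β` have the same image branch in `𝔾̃_j`, then `α'` may be chosen with the same image as `β'`
in `𝔾̃_j`** (`exists_fixed_branch_transport_sameImage`).  Proof: the element of `Gal(𝒢_{∞,n}/𝒢)`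
carrying `β` to `α` normalises the (cyclic) image of `C`; multiplying it by an element of the stabiliser
of `α` (which is abelian, contains the image of `C`, and surjects onto the stabiliser of the level-`j`
image of `α`) one may take it in the KERNEL of `Gal(𝒢_{∞,n}/𝒢) → Gal(𝒢_{∞,j}/𝒢)`, so that it moves
nothing at level `j` — abc-iut-f-176 gen 4's desk «balloons normalise: conjugation by the vertex
level-kernel» (HOME/staging/f/f-176/g4/FINDING-core-bouquet.md §3) in tree-system form.  Helper:
`PointSeq.treeTrans_branchMap_brOf_gal_pt` (the level-`j` image of the branch `brOf b (σ · pt_n)` is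
`brOf b (σ̄ · pt_j)`, `σ̄` the image of `σ`; cousin of abc-iut-w6-d062's `treeTrans_branchMap_brOf_smul_pt`).

Honest framing: one sufficient condition (topologically cyclic edge groups); the ∀-closures F-2773 /
F-1732 are NOT claimed; nothing here bears on [IUTchIII] Cor. 3.12; typed ≠ proved elsewhere.
-/

namespace Literature.AnabelianGeometry.SemiGraphs

namespace ProfiniteSemiGraph

namespace GaloisLevelData

open CategoryTheory Topology

open Literature.AlgebraicGeometry.Frobenioids.QuasiTemperoid.BTempConnected (ρ_one_apply
  ρ_mul_apply ρ_inv_apply)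

universe u

variable {𝒢 : ProfiniteSemiGraph.{u}} {D : GaloisLevelData 𝒢} {h𝒢 : 𝒢.IsCountable}

/-- `treeIso.hom` is injective on branches. [cite: MochizukiSemiAnbd2006, Prop 3.6 p.38] -/
theorem treeIso_hom_branchMap_injective (D : GaloisLevelData 𝒢) (h𝒢 : 𝒢.IsCountable) (n : ℕ) :
    Function.Injective (D.treeIso h𝒢 n).hom.branchMap := fun β₁ β₂ h => by
  have h' := congrArg (D.treeIso h𝒢 n).inv.branchMap h
  rwa [D.treeIso_inv_branchMap_hom h𝒢, D.treeIso_inv_branchMap_hom h𝒢] at h'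

/-- `treeIso.hom` is injective on vertices. [cite: MochizukiSemiAnbd2006, Prop 3.6 p.38] -/
theorem treeIso_hom_vertexMap_injective (D : GaloisLevelData 𝒢) (h𝒢 : 𝒢.IsCountable) (n : ℕ) :
    Function.Injective (D.treeIso h𝒢 n).hom.vertexMap := fun V₁ V₂ h => by
  have h' := congrArg (D.treeIso h𝒢 n).inv.vertexMap h
  rwa [D.treeIso_inv_vertexMap_hom h𝒢, D.treeIso_inv_vertexMap_hom h𝒢] at h'

namespace PointSeq

variable {w : 𝒢.graph.Vertex} (P : D.PointSeq h𝒢 w)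

/-! ### Images of the branches `brOf b (σ · pt)` under the tree transitions -/

/-- **Transport of `brOf b (σ · P.pt n)` along the transitions**: its image in `𝔾̃_j` (`j ≤ n`) is
`brOf b (σ̄ · P.pt j)` with `σ̄` the image of `σ ∈ Gal(𝒢_{∞,n}/𝒢)` in `Gal(𝒢_{∞,j}/𝒢)` (the covering maps
of the tower intertwine `σ` and `σ̄` and the point sequence is compatible).
[cite: MochizukiSemiAnbd2006, Prop 3.6 p.38] -/
theorem treeTrans_branchMap_brOf_gal_pt (b : 𝒢.graph.Branch) (hb : 𝒢.graph.abuts b = some w)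
    {j n : ℕ} (h : j ≤ n) (σ : D.Gal h𝒢 n) :
    (D.treeTrans h).branchMap ((D.treeIso h𝒢 n).hom.branchMap
        ((D.cover h𝒢 n).brOf b hb ((σ.hom.fV w).hom.hom (P.pt n)))) =
      (D.treeIso h𝒢 j).hom.branchMap
        ((D.cover h𝒢 j).brOf b hb (((D.mapLE h𝒢 h σ).hom.fV w).hom.hom (P.pt j))) := by
  induction n, h using Nat.le_induction with
  | base => rw [D.treeTrans_self, D.mapLE_self]; rfl
  | succ k h ih =>
    have hstep : ((D.stepCover h𝒢 k).fV w).hom.hom ((σ.hom.fV w).hom.hom (P.pt (k + 1))) =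
        ((D.step h𝒢 k σ).hom.fV w).hom.hom (P.pt k) := by
      rw [D.stepCover_apply_aut h𝒢 k σ, P.compat k]
    rw [D.treeTrans_succ h, SemiGraph.comp_branchMap, Function.comp_apply,
      D.treeStep_branchMap_brOf h𝒢 k b hb, hstep, ih (D.step h𝒢 k σ), D.mapLE_succ h𝒢 h,
      MonoidHom.comp_apply]

/-- The images of `σ_n^h` along the transition homomorphisms: `mapLE (σ_n^h) = σ_j^h`.
[cite: MochizukiSemiAnbd2006, Prop 3.6 p.38] -/
theorem mapLE_gal {j n : ℕ} (h : j ≤ n) (k : 𝒢.Gv w) : D.mapLE h𝒢 h (P.gal n k) = P.gal j k :=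
  D.mapLE_of_step h𝒢 (fun m => P.gal m k) (fun m => P.step_gal m k) h

/-! ### Cover coordinates of a tree branch over `b` at a vertex over `w` -/

/-- Every tree branch of `𝔾̃_n` over the base branch `b` (at `w`) abutting to a vertex over `w` is
`brOf b (τ · P.pt n)` for some `τ ∈ Gal(𝒢_{∞,n}/𝒢)`, read through `treeIso`.
[cite: MochizukiSemiAnbd2006, Rmk 2.2.1 p.24] -/
theorem exists_gal_eq_treeIso_brOf (n : ℕ) (b : 𝒢.graph.Branch) (hb : 𝒢.graph.abuts b = some w)
    (γ : (D.tree n).Branch) (hγb : (D.treeProj n).branchMap γ = b) {u : (D.tree n).Vertex}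
    (hγ : (D.tree n).abuts γ = some u) (hu : (D.treeProj n).vertexMap u = w) :
    ∃ τ : D.Gal h𝒢 n, γ = (D.treeIso h𝒢 n).hom.branchMap
        ((D.cover h𝒢 n).brOf b hb ((τ.hom.fV w).hom.hom (P.pt n))) ∧
      u = (D.treeIso h𝒢 n).hom.vertexMap (Quot.mk _ ⟨w, (τ.hom.fV w).hom.hom (P.pt n)⟩) := by
  set γ₀ := (D.treeIso h𝒢 n).inv.branchMap γ with hγ₀
  have hγeq : γ = (D.treeIso h𝒢 n).hom.branchMap γ₀ := (D.treeIso_hom_branchMap_inv h𝒢 n γ).symm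
  have hγ₀b : γ₀.1.1 = b := by rw [← hγb, hγeq, D.treeProj_branchMap_treeIso h𝒢]
  obtain ⟨y, hy⟩ := (D.cover h𝒢 n).exists_eq_brOf b hb γ₀ hγ₀b
  obtain ⟨τ, hτ⟩ := P.exists_gal_fV_eq n y
  refine ⟨τ, by rw [hγeq, hy, hτ], ?_⟩
  -- the vertex of `γ` is the orbit of `y = τ · pt`
  obtain ⟨P', hP'⟩ := P.exists_pointSeq_vertex_eq_of_treeProj n u hu
  have hγu : (D.tree n).abuts γ = some ((D.treeIso h𝒢 n).hom.vertexMap (Quot.mk _ ⟨w, P'.pt n⟩)) := by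
    rw [hγ, ← hP']; rfl
  rw [hγeq] at hγu
  have h₀ := D.orbitGraph_abuts_of_tree_abuts h𝒢 n γ₀ _ hγu
  rw [hy, (D.cover h𝒢 n).abuts_brOf b hb y] at h₀
  rw [← hP', hτ]
  exact congrArg _ (Option.some.inj h₀).symm

/-- Point form of «`C` fixes the edge of `brOf b (τ · pt)`»: every `q` in the image of `C` satisfies
`k · q(τ · pt) = τ · pt` for some `k ∈ Π_b`. [cite: MochizukiSemiAnbd2006, Rmk 2.2.1 p.24] -/
theorem forall_exists_branchSubgroup_ρ_apply_eq_of_edgeMap_eq (n : ℕ) (b : 𝒢.graph.Branch)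
    (hb : 𝒢.graph.abuts b = some w) (τ : D.Gal h𝒢 n) (C : Subgroup (D.temperedPi h𝒢))
    (hfix : ∀ g ∈ C, (D.treeAct h𝒢 n g).hom.edgeMap ((D.tree n).edgeOf ((D.treeIso h𝒢 n).hom.branchMap
        ((D.cover h𝒢 n).brOf b hb ((τ.hom.fV w).hom.hom (P.pt n))))) =
      (D.tree n).edgeOf ((D.treeIso h𝒢 n).hom.branchMap
        ((D.cover h𝒢 n).brOf b hb ((τ.hom.fV w).hom.hom (P.pt n))))) :
    ∀ q ∈ C.map (D.proj h𝒢 n), ∃ k ∈ 𝒢.branchSubgroup b w hb, ((D.cover h𝒢 n).SV w).obj.ρ k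
        ((q.hom.fV w).hom.hom ((τ.hom.fV w).hom.hom (P.pt n))) = (τ.hom.fV w).hom.hom (P.pt n) := by
  rintro _ ⟨g, hg, rfl⟩
  set γ := (D.treeIso h𝒢 n).hom.branchMap
    ((D.cover h𝒢 n).brOf b hb ((τ.hom.fV w).hom.hom (P.pt n))) with hγ
  have hfixbr : (D.treeAct h𝒢 n g).hom.branchMap γ = γ :=
    SemiGraph.branchMap_eq_of_over_aut (D.treeProj n) (D.treeAct h𝒢 n g) (D.treeAct_over h𝒢 n g) γ
      (hfix g hg)
  have h1 := hfixbr
  rw [hγ, D.treeAct_apply, D.galTreeAct_branchMap_treeIso h𝒢] at h1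
  have h2 := congrArg (D.treeIso h𝒢 n).inv.branchMap h1
  rw [D.treeIso_inv_branchMap_hom h𝒢, D.treeIso_inv_branchMap_hom h𝒢,
    (D.cover h𝒢 n).branchMap_brOf b hb, (D.cover h𝒢 n).brOf_eq_brOf_iff b hb] at h2
  exact h2

/-- An automorphism of `𝒢_{∞,n}` fixing the base point `P.pt n` is trivial (rigidity).
[cite: MochizukiSemiAnbd2006, Thm 3.7(i) p.40] -/
theorem eq_one_of_fV_pt_eq (n : ℕ) (η : D.Gal h𝒢 n) (hη : (η.hom.fV w).hom.hom (P.pt n) = P.pt n) :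
    η = 1 := by
  rw [← P.gal_one n]
  apply P.eq_gal
  rw [hη, inv_one, ρ_one_apply]

/-! ### LOCAL TRANSPORT at one level preserving the image at a lower level, tree form -/

end PointSeq

/-- **LOCAL TRANSPORT of fixed branches between two tree vertices over one base vertex, preserving the
images at a lower level** ([SemiAnbd] Thm 3.7 (iii) / Comments (6)(b) at ONE level `n` of a Galois tower,
for a TOPOLOGICALLY CYCLIC edge group `Π_{e(b₀)}`; refinement of abc-iut-f-175's
`exists_fixed_branch_transport`).  Let `j ≤ n`, let `v_a`, `v` be vertices of `𝔾̃_n` over the base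
vertex `w` (over which a compatible point sequence `P₀` is given), let a subgroup `C` of `π₁^temp(𝒢)` fix
(at level `n`) the edge of a branch `α` at `v_a` over the base branch `b₀`, and the edges of two branches
`β`, `β'` at `v` over `b₀` and over `b₁`, and suppose `α` and `β` have THE SAME IMAGE in `𝔾̃_j`.  Then `C`
fixes the edge of some branch `α'` at `v_a` over `b₁` WHOSE IMAGE IN `𝔾̃_j` IS THAT OF `β'`.  (The element
of `Gal(𝒢_{∞,n}/𝒢)` carrying `β` to `α` normalises the image of `C` — conjugates inside the one finite
cyclic image of `Π_{b₀}` are determined by their order — and may be taken in the kernel of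
`Gal(𝒢_{∞,n}/𝒢) → Gal(𝒢_{∞,j}/𝒢)`.) [cite: MochizukiSemiAnbd2006, Thm 3.7(iii) p.41] -/
theorem exists_fixed_branch_transport_sameImage (D : GaloisLevelData 𝒢) (h𝒢 : 𝒢.IsCountable)
    {j n : ℕ} (hjn : j ≤ n)
    (C : Subgroup (D.temperedPi h𝒢)) {w : 𝒢.graph.Vertex} (P₀ : D.PointSeq h𝒢 w)
    {b₀ b₁ : 𝒢.graph.Branch} (hb₀ : 𝒢.graph.abuts b₀ = some w) (hb₁ : 𝒢.graph.abuts b₁ = some w)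
    (t₀ : 𝒢.Ge (𝒢.graph.edgeOf b₀)) (hgen : (Subgroup.zpowers t₀).topologicalClosure = ⊤)
    {va v : (D.tree n).Vertex} (hva : (D.treeProj n).vertexMap va = w)
    (hv : (D.treeProj n).vertexMap v = w)
    (α β β' : (D.tree n).Branch) (hα : (D.tree n).abuts α = some va)
    (hαb : (D.treeProj n).branchMap α = b₀) (hβ : (D.tree n).abuts β = some v)
    (hβb : (D.treeProj n).branchMap β = b₀) (hβ' : (D.tree n).abuts β' = some v)
    (hβ'b : (D.treeProj n).branchMap β' = b₁)
    (himg : (D.treeTrans hjn).branchMap α = (D.treeTrans hjn).branchMap β)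
    (hfixα : ∀ g ∈ C, (D.treeAct h𝒢 n g).hom.edgeMap ((D.tree n).edgeOf α) = (D.tree n).edgeOf α)
    (hfixβ : ∀ g ∈ C, (D.treeAct h𝒢 n g).hom.edgeMap ((D.tree n).edgeOf β) = (D.tree n).edgeOf β)
    (hfixβ' : ∀ g ∈ C, (D.treeAct h𝒢 n g).hom.edgeMap ((D.tree n).edgeOf β') = (D.tree n).edgeOf β') :
    ∃ α' : (D.tree n).Branch, (D.tree n).abuts α' = some va ∧ (D.treeProj n).branchMap α' = b₁ ∧
      (D.treeTrans hjn).branchMap α' = (D.treeTrans hjn).branchMap β' ∧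
      ∀ g ∈ C, (D.treeAct h𝒢 n g).hom.edgeMap ((D.tree n).edgeOf α') = (D.tree n).edgeOf α' := by
  classical
  obtain ⟨P, hPv⟩ : ∃ P : D.PointSeq h𝒢 w, P.vertex n = v := P₀.exists_pointSeq_vertex_eq_of_treeProj n v hv
  -- cover coordinates of the three branches
  obtain ⟨σa, hαeq, hvaeq⟩ := P.exists_gal_eq_treeIso_brOf n b₀ hb₀ α hαb hα hva
  obtain ⟨σ, hβeq, hvσ⟩ := P.exists_gal_eq_treeIso_brOf n b₀ hb₀ β hβb hβ hv
  obtain ⟨σ', hβ'eq, hvσ'⟩ := P.exists_gal_eq_treeIso_brOf n b₁ hb₁ β' hβ'b hβ' hv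
  -- notation for points
  set pt := P.pt n with hpt
  -- the images at level `j` agree: `brOf b₀ (σ̄a · pt_j) = brOf b₀ (σ̄ · pt_j)`
  have himg' : (D.cover h𝒢 j).brOf b₀ hb₀ (((D.mapLE h𝒢 hjn σa).hom.fV w).hom.hom (P.pt j)) =
      (D.cover h𝒢 j).brOf b₀ hb₀ (((D.mapLE h𝒢 hjn σ).hom.fV w).hom.hom (P.pt j)) := by
    apply D.treeIso_hom_branchMap_injective h𝒢 j
    rw [← P.treeTrans_branchMap_brOf_gal_pt b₀ hb₀ hjn σa, ← P.treeTrans_branchMap_brOf_gal_pt b₀ hb₀ hjn σ,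
      ← hαeq, ← hβeq, himg]
  obtain ⟨k, hk, hkρ⟩ := ((D.cover h𝒢 j).brOf_eq_brOf_iff b₀ hb₀ _ _).mp himg'
  -- the adjusted representative `σa'' := σa · σ_n^{k⁻¹}` of `α`, with image `σ̄` at level `j`
  set σa'' : D.Gal h𝒢 n := σa * P.gal n k⁻¹ with hσa''
  have hσa''pt : (σa''.hom.fV w).hom.hom pt = ((D.cover h𝒢 n).SV w).obj.ρ k ((σa.hom.fV w).hom.hom pt) := by
    rw [hσa'', PointSeq.mul_fV_apply, P.gal_apply, inv_inv, CovHom.fV_ρ]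
  have hmapLE : D.mapLE h𝒢 hjn σa'' = D.mapLE h𝒢 hjn σ := by
    rw [hσa'', map_mul, P.mapLE_gal hjn]
    -- both sides agree on `pt_j`
    have hpt' : (((D.mapLE h𝒢 hjn σa * P.gal j k⁻¹).hom.fV w).hom.hom (P.pt j)) =
        ((D.mapLE h𝒢 hjn σ).hom.fV w).hom.hom (P.pt j) := by
      rw [PointSeq.mul_fV_apply, P.gal_apply, inv_inv, CovHom.fV_ρ, hkρ]
    have h1 : (D.mapLE h𝒢 hjn σ)⁻¹ * (D.mapLE h𝒢 hjn σa * P.gal j k⁻¹) = 1 := by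
      apply P.eq_one_of_fV_pt_eq j
      rw [PointSeq.mul_fV_apply, hpt', PointSeq.inv_fV_apply]
    rw [inv_mul_eq_one] at h1
    exact h1.symm
  -- `α` in the adjusted coordinates
  have hαeq'' : α = (D.treeIso h𝒢 n).hom.branchMap
      ((D.cover h𝒢 n).brOf b₀ hb₀ ((σa''.hom.fV w).hom.hom pt)) := by
    rw [hαeq, hσa''pt]
    congr 1
    exact ((D.cover h𝒢 n).brOf_eq_brOf_iff b₀ hb₀ _ _).mpr ⟨k, hk, rfl⟩
  have horb'' : (Quot.mk (D.cover h𝒢 n).VRel ⟨w, (σa''.hom.fV w).hom.hom pt⟩ : (D.cover h𝒢 n).OVertex) =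
      Quot.mk (D.cover h𝒢 n).VRel ⟨w, (σa.hom.fV w).hom.hom pt⟩ := by
    rw [hσa''pt]
    exact (Quot.sound (CovObj.VRel.mk (S := D.cover h𝒢 n) w k _)).symm
  -- point forms of the three fixedness hypotheses
  have hMα : ∀ q ∈ C.map (D.proj h𝒢 n), ∃ k' ∈ 𝒢.branchSubgroup b₀ w hb₀, ((D.cover h𝒢 n).SV w).obj.ρ k'
      ((q.hom.fV w).hom.hom ((σa''.hom.fV w).hom.hom pt)) = (σa''.hom.fV w).hom.hom pt :=
    P.forall_exists_branchSubgroup_ρ_apply_eq_of_edgeMap_eq n b₀ hb₀ σa'' C (by rw [← hpt, ← hαeq'']; exact hfixα)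
  have hMβ : ∀ q ∈ C.map (D.proj h𝒢 n), ∃ k' ∈ 𝒢.branchSubgroup b₀ w hb₀, ((D.cover h𝒢 n).SV w).obj.ρ k'
      ((q.hom.fV w).hom.hom ((σ.hom.fV w).hom.hom pt)) = (σ.hom.fV w).hom.hom pt :=
    P.forall_exists_branchSubgroup_ρ_apply_eq_of_edgeMap_eq n b₀ hb₀ σ C (by rw [← hpt, ← hβeq]; exact hfixβ)
  have hMβ' : ∀ q ∈ C.map (D.proj h𝒢 n), ∃ k' ∈ 𝒢.branchSubgroup b₁ w hb₁, ((D.cover h𝒢 n).SV w).obj.ρ k'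
      ((q.hom.fV w).hom.hom ((σ'.hom.fV w).hom.hom pt)) = (σ'.hom.fV w).hom.hom pt :=
    P.forall_exists_branchSubgroup_ρ_apply_eq_of_edgeMap_eq n b₁ hb₁ σ' C (by rw [← hpt, ← hβ'eq]; exact hfixβ')
  -- the one-level transport of abc-iut-f-175, point form
  have htr := P.forall_exists_branchSubgroup_ρ_apply_eq_transport n hb₀ hb₁ t₀ hgen
    (C.map (D.proj h𝒢 n)) σa'' σ σ' hMα hMβ hMβ'
  set z := ((σa'' * σ⁻¹ * σ').hom.fV w).hom.hom pt with hz
  -- `σ · pt` and `σ' · pt` both lie in the orbit `v`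
  have hσσ' : (Quot.mk (D.cover h𝒢 n).VRel ⟨w, (σ.hom.fV w).hom.hom pt⟩ : (D.cover h𝒢 n).OVertex) =
      Quot.mk (D.cover h𝒢 n).VRel ⟨w, (σ'.hom.fV w).hom.hom pt⟩ := by
    have h1 := hvσ.symm.trans hvσ'
    exact D.treeIso_hom_vertexMap_injective h𝒢 n h1
  refine ⟨(D.treeIso h𝒢 n).hom.branchMap ((D.cover h𝒢 n).brOf b₁ hb₁ z), ?_, ?_, ?_, ?_⟩
  · -- abuts `v_a`: the orbit of `z` is that of `σa'' · pt`, i.e. of `σa · pt`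
    have horb : (Quot.mk (D.cover h𝒢 n).VRel ⟨w, z⟩ : (D.cover h𝒢 n).OVertex) =
        Quot.mk (D.cover h𝒢 n).VRel ⟨w, (σa.hom.fV w).hom.hom pt⟩ := by
      rw [hz, P.mk_mul_inv_mul_fV_eq n σa'' σ σ' hσσ', horb'']
    have h := (D.treeIso h𝒢 n).hom.abuts_branchMap _ _ ((D.cover h𝒢 n).abuts_brOf b₁ hb₁ z)
    rw [h, horb, ← hvaeq]
  · rw [D.treeProj_branchMap_treeIso h𝒢]
    rfl
  · -- same image as `β'` at level `j`
    rw [hz, hβ'eq, P.treeTrans_branchMap_brOf_gal_pt b₁ hb₁ hjn, P.treeTrans_branchMap_brOf_gal_pt b₁ hb₁ hjn,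
      map_mul, map_mul, map_inv, hmapLE, mul_inv_cancel, one_mul]
  · intro g hg
    have hq : D.proj h𝒢 n g ∈ C.map (D.proj h𝒢 n) := ⟨g, hg, rfl⟩
    obtain ⟨k', hk', hkz⟩ := htr _ hq
    have hbr : (CovObj.orbitGraphMap (D.proj h𝒢 n g).hom).branchMap ((D.cover h𝒢 n).brOf b₁ hb₁ z) =
        (D.cover h𝒢 n).brOf b₁ hb₁ z := by
      rw [(D.cover h𝒢 n).branchMap_brOf b₁ hb₁, (D.cover h𝒢 n).brOf_eq_brOf_iff b₁ hb₁]
      exact ⟨k', hk', hkz⟩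
    have hbr' : (D.treeAct h𝒢 n g).hom.branchMap
        ((D.treeIso h𝒢 n).hom.branchMap ((D.cover h𝒢 n).brOf b₁ hb₁ z)) =
        (D.treeIso h𝒢 n).hom.branchMap ((D.cover h𝒢 n).brOf b₁ hb₁ z) := by
      rw [D.treeAct_apply, D.galTreeAct_branchMap_treeIso h𝒢, hbr]
    rw [← (D.treeAct h𝒢 n g).hom.edgeOf_branchMap, hbr']

end GaloisLevelData

end ProfiniteSemiGraph

end Literature.AnabelianGeometry.SemiGraphs
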